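import Summits.NavierStokesRegularity.NavierStokesRegularity.Theses.TypeIQuarterGate
import Summits.NavierStokesRegularity.NavierStokesRegularity.Theorems.TypeIQuarterGateLorentzUpgradeIffQuarterLaw
import Literature.Analysis.FunctionSpaces.WeakLpQuantitative
import HarnessLib

/-!
# `TypeIQuarterGate`: the Lorentz Type-I bound in the LEVEL-TRUNCATED ENERGY language
# (crux `QuarterLawTypeI`, stmt-NavierStokesRegularity-23726; open stub `stub_lorentzUpgrade` = item 24108)

`--supports stmt-NavierStokesRegularity-23726` (helper, def-free).  The registered line `lorentz-upgrade`
is at its fixed point: its open stub is the item `LorentzUpgradeTypeI` (24108, time-Type-I ⟹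
`sup_{t<T} sup_λ λ³|{λ < ‖u(t)‖}| < ∞`) ⟺ the crux (tree
`LorentzOfEnvelope.lorentzUpgradeTypeI_iff_quarterLawTypeI`).  The line card (24108, P-L2) names "the
equivalent high-amplitude energy law `E_{>λ}(t) ≤ C/λ`" without a tree statement; this file supplies
it, together with the De Giorgi–Vasseur truncation form, per slice and BY NAME.

Per slice (`f` a.e.-strongly measurable on any measure space; `W := sup_λ λ³ μ{λ < ‖f‖}`,
`E_{>λ} := ∫_{λ<‖f‖} ‖f‖²`, `D_λ := ∫ (‖f‖ − λ)₊²`):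
* `cube_mul_meas_lt_le_mul_setLIntegral` — Chebyshev on the superlevel set: `λ³ μ{λ<‖f‖} ≤ λ E_{>λ}`;
* `eWeakLpPow_three_le_of_highAmplitudeEnergy` — hence `W ≤ sup_λ λ E_{>λ}`;
* `highAmplitudeEnergy_le_of_eWeakLpPow` — conversely `λ E_{>λ} ≤ 3 W` (layer cake; the tree's
  `MemWeakLp.lintegral_rpow_indicator_lt_norm_le`, Barker–Seregin–Šverák (2.5));
* `lintegral_truncation_sq_le_highAmplitudeEnergy` / `highAmplitudeEnergy_le_four_mul_truncation_sq` —
  `D_λ ≤ E_{>λ} ≤ 4 D_{λ/2}` (pointwise: `(‖f‖−λ)₊ ≤ 𝟙_{‖f‖>λ}‖f‖ ≤ 2(‖f‖−λ/2)₊`).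
Per solution (classical on `[0,T)`, slices continuous): `lorentzBound_iff_highAmplitudeEnergyLaw`,
`lorentzBound_iff_truncationEnergyLaw`; and with the Leray–Hopf energy bound the SMALL amplitudes are
free (`λ E_{>λ}(t) ≤ Λ·2E(u₀)` for `λ ≤ Λ`): `highAmplitudeEnergyLaw_of_large`.
BY NAME: `lorentzUpgradeTypeI_iff_highAmplitudeEnergyLaw`, `lorentzUpgradeTypeI_iff_truncationEnergyLaw`,
`lorentzUpgradeTypeI_iff_largeAmplitudeEnergyLawEventually` (only amplitudes `λ ≥ Λ` at times near `T`
matter; early times by the tree's `LorentzOfEnvelope.lorentzBound_of_eventually`), and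
`quarterLawTypeI_iff_truncationEnergyLaw`.

Why this language: `E_{>λ}` and `D_λ` are the level-set energies of the De Giorgi–Vasseur truncation
method for Navier–Stokes (truncations `v_k = (‖u‖ − λ_k)₊`, energies `U_k = sup_t ∫v_k² + ∫∫|∇v_k|²`),
so 24108 reads: along a sup-norm Type-I blow-up the truncation energies obey the CRITICAL law
`λ · sup_t ∫(‖u(t)‖−λ)₊² ≤ C` uniformly in the level; under the rate only the levels
`Λ ≤ λ ≤ C₀/√(T−t)` are populated and non-trivial.  Since the law is false for the Navier–Stokes
INEQUALITY (Scheffer–Ożański Type-I cascade, see the docstring of `LorentzUpgradeTypeI`), a proof must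
feed NSE-only structure into the truncated energy inequalities; nothing of that is done here.

HONEST FRAMING: reformulations along a HYPOTHETICAL blow-up; `LorentzUpgradeTypeI` (24108) and
`QuarterLawTypeI` (23726) remain OPEN; nothing about Navier–Stokes regularity or blow-up is claimed and
no summit statement is proved. [cite: BarkerSeregin2016, Lemma 2.1 (2.5)]
-/

noncomputable section

-- the summit-side namespace repeats a component by design (D-0017)
set_option linter.dupNamespace false

namespace Summit.NavierStokesRegularity.NavierStokesRegularity.Theorems.LorentzAmplitude

open Set MeasureTheory Function Metric Filter Topology
open scoped ENNReal NNReal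
open Literature.Analysis.FluidPDE Literature.Analysis.FunctionSpaces

/-! ### Per slice: weak-`L³` quasinorm versus level-truncated energies -/

section Slice

variable {α : Type*} [MeasurableSpace α] {E : Type*} [NormedAddCommGroup E] {μ : Measure α}
  {f : α → E}

/-- **Chebyshev on the superlevel set**: `λ³ μ{λ < ‖f‖} ≤ λ ∫_{λ<‖f‖} ‖f‖²` (`λ > 0`), for `f`
a.e.-strongly measurable. [folklore] -/
theorem cube_mul_meas_lt_le_mul_setLIntegral (hf : AEStronglyMeasurable f μ) {lam : ℝ}
    (hlam : 0 < lam) :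
    ENNReal.ofReal (lam ^ 3) * μ {x | lam < ‖f x‖} ≤
      ENNReal.ofReal lam * ∫⁻ x in {x | lam < ‖f x‖}, ‖f x‖ₑ ^ 2 ∂μ := by
  have hA : NullMeasurableSet {x | lam < ‖f x‖} μ :=
    nullMeasurableSet_lt aemeasurable_const hf.norm.aemeasurable
  have h1 : ENNReal.ofReal (lam ^ 2) * μ {x | lam < ‖f x‖} ≤
      ∫⁻ x in {x | lam < ‖f x‖}, ‖f x‖ₑ ^ 2 ∂μ := by
    calc ENNReal.ofReal (lam ^ 2) * μ {x | lam < ‖f x‖}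
        = ∫⁻ _ in {x | lam < ‖f x‖}, ENNReal.ofReal (lam ^ 2) ∂μ := (setLIntegral_const _ _).symm
      _ ≤ ∫⁻ x in {x | lam < ‖f x‖}, ‖f x‖ₑ ^ 2 ∂μ := by
          refine lintegral_mono_ae ((ae_restrict_mem₀ hA).mono fun x hx => ?_)
          have hx' : lam < ‖f x‖ := hx
          rw [← ofReal_norm, ← ENNReal.ofReal_pow (norm_nonneg _)]
          exact ENNReal.ofReal_le_ofReal (by nlinarith [norm_nonneg (f x)])
  calc ENNReal.ofReal (lam ^ 3) * μ {x | lam < ‖f x‖}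
      = ENNReal.ofReal lam * (ENNReal.ofReal (lam ^ 2) * μ {x | lam < ‖f x‖}) := by
        rw [← mul_assoc, ← ENNReal.ofReal_mul hlam.le]; ring_nf
    _ ≤ ENNReal.ofReal lam * ∫⁻ x in {x | lam < ‖f x‖}, ‖f x‖ₑ ^ 2 ∂μ := mul_le_mul' le_rfl h1

/-- **High-amplitude energy law ⟹ weak-`L³` bound**: if `λ ∫_{λ<‖f‖} ‖f‖² ≤ C` for every `λ > 0`,
then `sup_λ λ³ μ{λ < ‖f‖} ≤ C`. [folklore] -/
theorem eWeakLpPow_three_le_of_highAmplitudeEnergy (hf : AEStronglyMeasurable f μ) {C : ℝ≥0∞}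
    (h : ∀ lam : ℝ, 0 < lam →
      ENNReal.ofReal lam * ∫⁻ x in {x | lam < ‖f x‖}, ‖f x‖ₑ ^ 2 ∂μ ≤ C) :
    eWeakLpPow f 3 μ ≤ C := by
  have h3 : (0 : ℝ) < (3 : ℝ≥0∞).toReal := by norm_num
  refine Wu2026Salvage.eWeakLpPow_le_of_forall h3 fun lam hlam => ?_
  have e3 : ENNReal.ofReal (lam ^ (3 : ℝ≥0∞).toReal) = ENNReal.ofReal (lam ^ 3) := by norm_num
  rw [e3]
  exact (cube_mul_meas_lt_le_mul_setLIntegral hf hlam).trans (h lam hlam)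

/-- **Weak-`L³` bound ⟹ high-amplitude energy law**: `λ ∫_{λ<‖f‖} ‖f‖² ≤ 3 · sup_t t³ μ{t < ‖f‖}`
for every `λ > 0` (layer cake: `∫_{λ<‖f‖}‖f‖² = λ² μ{‖f‖>λ} + 2∫_λ^∞ s μ{‖f‖>s} ds ≤ 3W/λ`;
the tree's `MemWeakLp.lintegral_rpow_indicator_lt_norm_le` with `p = 3`, `r = 2`).
[cite: BarkerSeregin2016, Lemma 2.1 (2.5)] -/
theorem highAmplitudeEnergy_le_of_eWeakLpPow (hf : AEStronglyMeasurable f μ) {lam : ℝ}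
    (hlam : 0 < lam) (hA : MeasurableSet {x | lam < ‖f x‖}) :
    ENNReal.ofReal lam * ∫⁻ x in {x | lam < ‖f x‖}, ‖f x‖ₑ ^ 2 ∂μ ≤ 3 * eWeakLpPow f 3 μ := by
  have h := MemWeakLp.lintegral_rpow_indicator_lt_norm_le (p := 3) (μ := μ) hf hA (r := 2)
    zero_lt_two (by rw [ENNReal.toReal_ofNat]; norm_num) hlam
  have hind : ∫⁻ x, ‖{x | lam < ‖f x‖}.indicator f x‖ₑ ^ (2 : ℝ) ∂μ =
      ∫⁻ x in {x | lam < ‖f x‖}, ‖f x‖ₑ ^ 2 ∂μ := by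
    rw [← lintegral_indicator hA]
    refine lintegral_congr fun x => ?_
    by_cases hx : x ∈ {x | lam < ‖f x‖}
    · rw [indicator_of_mem hx, indicator_of_mem hx, ← ENNReal.rpow_natCast]
      norm_num
    · rw [indicator_of_notMem hx, indicator_of_notMem hx, enorm_zero,
        ENNReal.zero_rpow_of_pos two_pos]
  rw [hind, ENNReal.toReal_ofNat] at h
  have hc : ENNReal.ofReal (3 / (3 - 2) * lam ^ ((2 : ℝ) - 3)) = ENNReal.ofReal (3 * lam⁻¹) := by
    rw [show (2 : ℝ) - 3 = -1 by norm_num, Real.rpow_neg_one]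
    norm_num
  rw [hc] at h
  calc ENNReal.ofReal lam * ∫⁻ x in {x | lam < ‖f x‖}, ‖f x‖ₑ ^ 2 ∂μ
      ≤ ENNReal.ofReal lam * (ENNReal.ofReal (3 * lam⁻¹) * eWeakLpPow f 3 μ) :=
        mul_le_mul' le_rfl h
    _ = 3 * eWeakLpPow f 3 μ := by
        rw [← mul_assoc, ← ENNReal.ofReal_mul hlam.le,
          show lam * (3 * lam⁻¹) = 3 by field_simp, ENNReal.ofReal_ofNat]

/-- **The De Giorgi truncation energy is below the high-amplitude energy**:
`∫ (‖f‖ − λ)₊² ≤ ∫_{λ<‖f‖} ‖f‖²` (`λ ≥ 0`; `ENNReal.ofReal` clips the negative part). [folklore] -/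
theorem lintegral_truncation_sq_le_highAmplitudeEnergy {lam : ℝ} (hlam : 0 ≤ lam)
    (hA : MeasurableSet {x | lam < ‖f x‖}) :
    ∫⁻ x, ENNReal.ofReal (‖f x‖ - lam) ^ 2 ∂μ ≤ ∫⁻ x in {x | lam < ‖f x‖}, ‖f x‖ₑ ^ 2 ∂μ := by
  rw [← lintegral_indicator hA]
  refine lintegral_mono fun x => ?_
  by_cases hx : x ∈ {x | lam < ‖f x‖}
  · rw [indicator_of_mem hx]
    have h1 : ENNReal.ofReal (‖f x‖ - lam) ≤ ‖f x‖ₑ := by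
      rw [← ofReal_norm]
      exact ENNReal.ofReal_le_ofReal (by linarith)
    exact pow_le_pow_left' h1 2
  · rw [indicator_of_notMem hx]
    have : ‖f x‖ - lam ≤ 0 := by
      simp only [mem_setOf_eq, not_lt] at hx
      linarith
    rw [ENNReal.ofReal_of_nonpos this, zero_pow two_ne_zero]

/-- **The high-amplitude energy is below four truncation energies at half the level**:
`∫_{λ<‖f‖} ‖f‖² ≤ 4 ∫ (‖f‖ − λ/2)₊²` (`λ ≥ 0`; on `{‖f‖ > λ}` one has `‖f‖ < 2(‖f‖ − λ/2)`).
[folklore] -/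
theorem highAmplitudeEnergy_le_four_mul_truncation_sq {lam : ℝ} (hlam : 0 ≤ lam)
    (hA : MeasurableSet {x | lam < ‖f x‖}) :
    ∫⁻ x in {x | lam < ‖f x‖}, ‖f x‖ₑ ^ 2 ∂μ ≤
      4 * ∫⁻ x, ENNReal.ofReal (‖f x‖ - lam / 2) ^ 2 ∂μ := by
  rw [← lintegral_indicator hA, ← lintegral_const_mul' _ _ (by norm_num)]
  refine lintegral_mono fun x => ?_
  by_cases hx : x ∈ {x | lam < ‖f x‖}
  · rw [indicator_of_mem hx]
    have hx' : lam < ‖f x‖ := hx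
    have h0 : 0 ≤ ‖f x‖ - lam / 2 := by linarith [norm_nonneg (f x)]
    calc ‖f x‖ₑ ^ 2 = ENNReal.ofReal (‖f x‖ ^ 2) := by
          rw [← ofReal_norm, ENNReal.ofReal_pow (norm_nonneg _)]
      _ ≤ ENNReal.ofReal (4 * (‖f x‖ - lam / 2) ^ 2) :=
          ENNReal.ofReal_le_ofReal (by nlinarith)
      _ = 4 * ENNReal.ofReal (‖f x‖ - lam / 2) ^ 2 := by
          rw [ENNReal.ofReal_mul (by norm_num), ENNReal.ofReal_ofNat, ENNReal.ofReal_pow h0]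
  · rw [indicator_of_notMem hx]
    exact zero_le

end Slice

/-! ### Per solution: the three slice laws along a classical solution on `[0,T)` -/

variable {ν T : ℝ} {u : ℝ → EuclideanSpace ℝ (Fin 3) → EuclideanSpace ℝ (Fin 3)}
  {p : ℝ → EuclideanSpace ℝ (Fin 3) → ℝ}

/-- Slices of a classical solution are continuous, so their superlevel sets are measurable. [folklore] -/
theorem measurableSet_lt_norm_slice (hsol : IsClassicalNSSolutionOn (Ico 0 T) ν 0 u p) {t : ℝ}
    (ht : t ∈ Ico 0 T) (lam : ℝ) : MeasurableSet {x | lam < ‖u t x‖} :=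
  (isOpen_lt continuous_const (hsol.contDiff_velocity ht).continuous.norm).measurableSet

/-- **Uniform weak-`L³` bound ⟺ high-amplitude energy law** along a classical solution on `[0,T)`:
`(∃ M', ∀ t, sup_λ λ³|{λ<‖u(t)‖}| ≤ M') ↔ (∃ C, ∀ t, ∀ λ>0, λ ∫_{λ<‖u(t)‖} ‖u(t)‖² ≤ C)`
(constants `C = 3M'`, `M' = C`). [folklore] -/
theorem lorentzBound_iff_highAmplitudeEnergyLaw (hsol : IsClassicalNSSolutionOn (Ico 0 T) ν 0 u p) :
    (∃ M' : ℝ, ∀ t ∈ Ico 0 T, eWeakLpPow (u t) 3 volume ≤ ENNReal.ofReal M') ↔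
      ∃ C : ℝ, ∀ t ∈ Ico 0 T, ∀ lam : ℝ, 0 < lam →
        ENNReal.ofReal lam * ∫⁻ x in {x | lam < ‖u t x‖}, ‖u t x‖ₑ ^ 2 ≤ ENNReal.ofReal C := by
  constructor
  · rintro ⟨M', hM'⟩
    refine ⟨3 * max M' 0, fun t ht lam hlam => ?_⟩
    have hcont : Continuous (u t) := (hsol.contDiff_velocity ht).continuous
    calc ENNReal.ofReal lam * ∫⁻ x in {x | lam < ‖u t x‖}, ‖u t x‖ₑ ^ 2
        ≤ 3 * eWeakLpPow (u t) 3 volume :=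
          highAmplitudeEnergy_le_of_eWeakLpPow hcont.aestronglyMeasurable hlam
            (measurableSet_lt_norm_slice hsol ht lam)
      _ ≤ 3 * ENNReal.ofReal (max M' 0) :=
          mul_le_mul' le_rfl ((hM' t ht).trans (ENNReal.ofReal_le_ofReal (le_max_left _ _)))
      _ = ENNReal.ofReal (3 * max M' 0) := by
          rw [ENNReal.ofReal_mul (by norm_num), ENNReal.ofReal_ofNat]
  · rintro ⟨C, hC⟩
    exact ⟨C, fun t ht => eWeakLpPow_three_le_of_highAmplitudeEnergy
      (hsol.contDiff_velocity ht).continuous.aestronglyMeasurable (fun lam hlam => hC t ht lam hlam)⟩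

/-- **Uniform weak-`L³` bound ⟺ De Giorgi truncation-energy law** along a classical solution on
`[0,T)`: `(∃ M', ∀ t, sup_λ λ³|{λ<‖u(t)‖}| ≤ M') ↔ (∃ C, ∀ t, ∀ λ>0, λ ∫ (‖u(t)‖−λ)₊² ≤ C)`
(constants `C = 3M'`, `M' = 8C`). [folklore] -/
theorem lorentzBound_iff_truncationEnergyLaw (hsol : IsClassicalNSSolutionOn (Ico 0 T) ν 0 u p) :
    (∃ M' : ℝ, ∀ t ∈ Ico 0 T, eWeakLpPow (u t) 3 volume ≤ ENNReal.ofReal M') ↔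
      ∃ C : ℝ, ∀ t ∈ Ico 0 T, ∀ lam : ℝ, 0 < lam →
        ENNReal.ofReal lam * ∫⁻ x, ENNReal.ofReal (‖u t x‖ - lam) ^ 2 ≤ ENNReal.ofReal C := by
  rw [lorentzBound_iff_highAmplitudeEnergyLaw hsol]
  constructor
  · rintro ⟨C, hC⟩
    refine ⟨C, fun t ht lam hlam => ?_⟩
    exact (mul_le_mul' le_rfl (lintegral_truncation_sq_le_highAmplitudeEnergy hlam.le
      (measurableSet_lt_norm_slice hsol ht lam))).trans (hC t ht lam hlam)
  · rintro ⟨C, hC⟩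
    refine ⟨8 * max C 0, fun t ht lam hlam => ?_⟩
    have h2 : 0 < lam / 2 := by positivity
    have hhalf := hC t ht (lam / 2) h2
    calc ENNReal.ofReal lam * ∫⁻ x in {x | lam < ‖u t x‖}, ‖u t x‖ₑ ^ 2
        ≤ ENNReal.ofReal lam * (4 * ∫⁻ x, ENNReal.ofReal (‖u t x‖ - lam / 2) ^ 2) :=
          mul_le_mul' le_rfl (highAmplitudeEnergy_le_four_mul_truncation_sq hlam.le
            (measurableSet_lt_norm_slice hsol ht lam))
      _ = 8 * (ENNReal.ofReal (lam / 2) * ∫⁻ x, ENNReal.ofReal (‖u t x‖ - lam / 2) ^ 2) := by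
          have e : ENNReal.ofReal lam * 4 = 8 * ENNReal.ofReal (lam / 2) := by
            rw [← ENNReal.ofReal_ofNat 8, ← ENNReal.ofReal_ofNat 4,
              ← ENNReal.ofReal_mul hlam.le, ← ENNReal.ofReal_mul (by norm_num)]
            congr 1
            ring
          rw [← mul_assoc, e, mul_assoc]
      _ ≤ 8 * ENNReal.ofReal C := mul_le_mul' le_rfl hhalf
      _ ≤ 8 * ENNReal.ofReal (max C 0) := mul_le_mul' le_rfl (ENNReal.ofReal_le_ofReal (le_max_left _ _))
      _ = ENNReal.ofReal (8 * max C 0) := by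
          rw [ENNReal.ofReal_mul (by norm_num), ENNReal.ofReal_ofNat]

/-- **The small amplitudes are free** (Leray–Hopf energy): if the high-amplitude law holds for the
levels `λ ≥ Λ` (`Λ ≥ 0`) on `[t₀,T) ⊆ [0,T)`, it holds for all `λ > 0` there, with constant
`max C (Λ · 2E(u₀))` — for `λ < Λ`, `λ ∫_{λ<‖u‖}‖u‖² ≤ Λ ∫‖u(t)‖² ≤ Λ · 2E(u₀)`. [cite: Leray1934, §31] -/
theorem highAmplitudeEnergyLaw_of_large (hν : 0 ≤ ν) (hLH : IsLerayHopfOn T ν 0 (u 0) u)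
    {C Λ t₀ : ℝ} (hΛ : 0 ≤ Λ) (ht₀ : 0 ≤ t₀)
    (h : ∀ t ∈ Ico t₀ T, ∀ lam : ℝ, Λ ≤ lam →
      ENNReal.ofReal lam * ∫⁻ x in {x | lam < ‖u t x‖}, ‖u t x‖ₑ ^ 2 ≤ ENNReal.ofReal C) :
    ∀ t ∈ Ico t₀ T, ∀ lam : ℝ, 0 < lam →
      ENNReal.ofReal lam * ∫⁻ x in {x | lam < ‖u t x‖}, ‖u t x‖ₑ ^ 2 ≤
        ENNReal.ofReal (max C (Λ * (2 * VectorCalculus.kineticEnergy (u 0)))) := by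
  intro t ht lam hlam
  rcases le_or_gt Λ lam with hle | hlt
  · exact (h t ht lam hle).trans (ENNReal.ofReal_le_ofReal (le_max_left _ _))
  · have htI : t ∈ Icc 0 T := ⟨ht₀.trans ht.1, ht.2.le⟩
    have hE := LorentzOfEnvelope.lintegral_sq_le_of_isLerayHopfOn hν hLH htI
    calc ENNReal.ofReal lam * ∫⁻ x in {x | lam < ‖u t x‖}, ‖u t x‖ₑ ^ 2
        ≤ ENNReal.ofReal Λ * ∫⁻ x, ‖u t x‖ₑ ^ 2 :=
          mul_le_mul' (ENNReal.ofReal_le_ofReal hlt.le) (setLIntegral_le_lintegral _ _)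
      _ ≤ ENNReal.ofReal Λ * ENNReal.ofReal (2 * VectorCalculus.kineticEnergy (u 0)) :=
          mul_le_mul' le_rfl hE
      _ = ENNReal.ofReal (Λ * (2 * VectorCalculus.kineticEnergy (u 0))) :=
          (ENNReal.ofReal_mul hΛ).symm
      _ ≤ _ := ENNReal.ofReal_le_ofReal (le_max_right _ _)

/-! ### BY NAME: the open item `LorentzUpgradeTypeI` (24108) in the truncated-energy language -/

open Summit.NavierStokesRegularity.NavierStokesRegularity.Theses.TypeIQuarterGate

/-- **BY NAME: `LorentzUpgradeTypeI` ⟺ the HIGH-AMPLITUDE ENERGY LAW** `λ ∫_{λ<‖u(t)‖}‖u(t)‖² ≤ C`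
for all `t ∈ [0,T)` and all levels `λ > 0`, along every sup-norm Type-I maximal classical Leray–Hopf
blow-up from a rapidly decaying datum.  `LorentzUpgradeTypeI` remains OPEN. [folklore] -/
theorem lorentzUpgradeTypeI_iff_highAmplitudeEnergyLaw :
    LorentzUpgradeTypeI ↔
      ∀ (ν T : ℝ), 0 < ν → 0 < T →
        ∀ (u : ℝ → EuclideanSpace ℝ (Fin 3) → EuclideanSpace ℝ (Fin 3))
          (p : ℝ → EuclideanSpace ℝ (Fin 3) → ℝ),
          IsMaximalSmoothSolution ν 0 u p T → IsLerayHopfOn T ν 0 (u 0) u →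
          HasRapidSpatialDecay (u 0) → IsTypeIBlowup u T →
          ∃ C : ℝ, ∀ t ∈ Set.Ico 0 T, ∀ lam : ℝ, 0 < lam →
            ENNReal.ofReal lam * ∫⁻ x in {x | lam < ‖u t x‖}, ‖u t x‖ₑ ^ 2 ≤ ENNReal.ofReal C := by
  unfold LorentzUpgradeTypeI
  constructor
  · intro h ν T hν hT u p hmax hLH hdec hI
    exact (lorentzBound_iff_highAmplitudeEnergyLaw hmax.1).1 (h ν T hν hT u p hmax hLH hdec hI)
  · intro h ν T hν hT u p hmax hLH hdec hI
    exact (lorentzBound_iff_highAmplitudeEnergyLaw hmax.1).2 (h ν T hν hT u p hmax hLH hdec hI)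

/-- **BY NAME: `LorentzUpgradeTypeI` ⟺ the DE GIORGI TRUNCATION-ENERGY LAW**
`λ ∫ (‖u(t)‖ − λ)₊² ≤ C` for all `t ∈ [0,T)` and all levels `λ > 0`, along every sup-norm Type-I
maximal classical Leray–Hopf blow-up from a rapidly decaying datum.  `LorentzUpgradeTypeI` remains
OPEN. [folklore] -/
theorem lorentzUpgradeTypeI_iff_truncationEnergyLaw :
    LorentzUpgradeTypeI ↔
      ∀ (ν T : ℝ), 0 < ν → 0 < T →
        ∀ (u : ℝ → EuclideanSpace ℝ (Fin 3) → EuclideanSpace ℝ (Fin 3))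
          (p : ℝ → EuclideanSpace ℝ (Fin 3) → ℝ),
          IsMaximalSmoothSolution ν 0 u p T → IsLerayHopfOn T ν 0 (u 0) u →
          HasRapidSpatialDecay (u 0) → IsTypeIBlowup u T →
          ∃ C : ℝ, ∀ t ∈ Set.Ico 0 T, ∀ lam : ℝ, 0 < lam →
            ENNReal.ofReal lam * ∫⁻ x, ENNReal.ofReal (‖u t x‖ - lam) ^ 2 ≤ ENNReal.ofReal C := by
  unfold LorentzUpgradeTypeI
  constructor
  · intro h ν T hν hT u p hmax hLH hdec hI
    exact (lorentzBound_iff_truncationEnergyLaw hmax.1).1 (h ν T hν hT u p hmax hLH hdec hI)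
  · intro h ν T hν hT u p hmax hLH hdec hI
    exact (lorentzBound_iff_truncationEnergyLaw hmax.1).2 (h ν T hν hT u p hmax hLH hdec hI)

/-- **BY NAME: `LorentzUpgradeTypeI` ⟺ the high-amplitude energy law for LARGE LEVELS NEAR `T`
only**: along every such blow-up there are `C, Λ` and `t₀ < T` with `λ ∫_{λ<‖u(t)‖}‖u(t)‖² ≤ C` for
all `t ∈ [t₀,T)` and `λ ≥ Λ` (small levels by the energy, `highAmplitudeEnergyLaw_of_large`; early
times by the tree's `LorentzOfEnvelope.lorentzBound_of_eventually`).  `LorentzUpgradeTypeI` remains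
OPEN. [folklore] -/
theorem lorentzUpgradeTypeI_iff_largeAmplitudeEnergyLawEventually :
    LorentzUpgradeTypeI ↔
      ∀ (ν T : ℝ), 0 < ν → 0 < T →
        ∀ (u : ℝ → EuclideanSpace ℝ (Fin 3) → EuclideanSpace ℝ (Fin 3))
          (p : ℝ → EuclideanSpace ℝ (Fin 3) → ℝ),
          IsMaximalSmoothSolution ν 0 u p T → IsLerayHopfOn T ν 0 (u 0) u →
          HasRapidSpatialDecay (u 0) → IsTypeIBlowup u T →
          ∃ C Λ t₀ : ℝ, t₀ < T ∧ ∀ t ∈ Set.Ico t₀ T, ∀ lam : ℝ, Λ ≤ lam →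
            ENNReal.ofReal lam * ∫⁻ x in {x | lam < ‖u t x‖}, ‖u t x‖ₑ ^ 2 ≤ ENNReal.ofReal C := by
  rw [lorentzUpgradeTypeI_iff_highAmplitudeEnergyLaw]
  constructor
  · intro h ν T hν hT u p hmax hLH hdec hI
    obtain ⟨C, hC⟩ := h ν T hν hT u p hmax hLH hdec hI
    exact ⟨C, 1, 0, hT, fun t ht lam hlam => hC t ht lam (lt_of_lt_of_le one_pos hlam)⟩
  · intro h ν T hν hT u p hmax hLH hdec hI
    obtain ⟨C, Λ, t₀, ht₀T, hC⟩ := h ν T hν hT u p hmax hLH hdec hI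
    -- normalise: `t₀' = max t₀ 0`, `Λ' = max Λ 0`
    set t₀' : ℝ := max t₀ 0 with ht₀'
    set Λ' : ℝ := max Λ 0 with hΛ'
    have hlarge : ∀ t ∈ Ico t₀' T, ∀ lam : ℝ, Λ' ≤ lam →
        ENNReal.ofReal lam * ∫⁻ x in {x | lam < ‖u t x‖}, ‖u t x‖ₑ ^ 2 ≤ ENNReal.ofReal C :=
      fun t ht lam hlam => hC t ⟨(le_max_left _ _).trans ht.1, ht.2⟩ lam ((le_max_left _ _).trans hlam)
    have hall := highAmplitudeEnergyLaw_of_large hν.le hLH (le_max_right Λ 0) (le_max_right t₀ 0) hlarge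
    -- the eventual weak-L³ bound, then the early times
    have hev : ∃ M t₁ : ℝ, t₁ < T ∧ ∀ t ∈ Ico t₁ T, eWeakLpPow (u t) 3 volume ≤ ENNReal.ofReal M :=
      ⟨max C (Λ' * (2 * VectorCalculus.kineticEnergy (u 0))), t₀', max_lt ht₀T hT, fun t ht =>
        eWeakLpPow_three_le_of_highAmplitudeEnergy
          (hmax.1.contDiff_velocity ⟨(le_max_right _ _).trans ht.1, ht.2⟩).continuous.aestronglyMeasurable
          (fun lam hlam => hall t ht lam hlam)⟩
    obtain ⟨M', hM'⟩ := LorentzOfEnvelope.lorentzBound_of_eventually hν hT hmax.1 hLH hdec hev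
    exact (lorentzBound_iff_highAmplitudeEnergyLaw hmax.1).1 ⟨M', hM'⟩

/-- **BY NAME: the crux `QuarterLawTypeI` ⟺ the DE GIORGI TRUNCATION-ENERGY LAW** along Type-I
blow-ups (via the tree's `LorentzOfEnvelope.lorentzUpgradeTypeI_iff_quarterLawTypeI`).
`QuarterLawTypeI` remains OPEN. [folklore] -/
theorem quarterLawTypeI_iff_truncationEnergyLaw :
    QuarterLawTypeI ↔
      ∀ (ν T : ℝ), 0 < ν → 0 < T →
        ∀ (u : ℝ → EuclideanSpace ℝ (Fin 3) → EuclideanSpace ℝ (Fin 3))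
          (p : ℝ → EuclideanSpace ℝ (Fin 3) → ℝ),
          IsMaximalSmoothSolution ν 0 u p T → IsLerayHopfOn T ν 0 (u 0) u →
          HasRapidSpatialDecay (u 0) → IsTypeIBlowup u T →
          ∃ C : ℝ, ∀ t ∈ Set.Ico 0 T, ∀ lam : ℝ, 0 < lam →
            ENNReal.ofReal lam * ∫⁻ x, ENNReal.ofReal (‖u t x‖ - lam) ^ 2 ≤ ENNReal.ofReal C :=
  LorentzOfEnvelope.lorentzUpgradeTypeI_iff_quarterLawTypeI.symm.trans
    lorentzUpgradeTypeI_iff_truncationEnergyLaw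

end Summit.NavierStokesRegularity.NavierStokesRegularity.Theorems.LorentzAmplitude

end
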